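import Mathlib
import Literature.Analysis.Calculus.SmoothCutoff
import Summits.SmoothPoincare4.SmoothPoincare4.Theorems.EntropyRungSubcylindricalExistenceCapProfileSlope

/-!
# The capping profile (stub `helper_capProfile`, K1, of line `fat-conical-core-avr-logsobolev`,
crux `EntropyRung.SubcylindricalExistence`, item stmt-SmoothPoincare4-10871)

Pure one-variable real analysis. Given `0 < c ≤ 1`, `κ₁ > 0`, `ℓ ≥ 1`, `smax > 0` we produce a
smooth `prof : ℝ → ℝ` and `0 < A`, `0 < a`, `0 < s_J < s_c ≤ smax` with: `prof(s) = 2Aa/(a² + s)`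
on `[0, s_J]` (round sphere of radius `A` in stereographic presentation, `s = ρ²`),
`prof(s) = c s^{-(c+1)/2}` on `[s_c, ∞)` (exact cone of slope `c`), `prof > 0`,
`2 prof' + s prof'' ≤ 0` (i.e. `Δ(prof(‖y‖²)) ≤ 0` on `ℝ⁴`, scalar curvature `≥ 0` of `prof² δ`),
`prof'(0) < 0`, and the log-slope `Q(s) = 2 s prof'(s)/prof(s)` is slowly varying,
`|Q(s₁) - Q(s₂)| ≤ κ₁` for `s_J e^{-2ℓ} ≤ s₁ ≤ s₂ ≤ s₁ e^{2ℓ}`, with range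
`-2 ≤ Q ≤ -(1 + c) + κ₁` beyond `s_J e^{-2ℓ}`.

Strategy. In log-radius `t = ½ log s` write `prof(s) = e^{W(t)}`; then `Q(s) = W'(t)` and
`2 prof' + s prof'' = e^{W} (W'' + W'(W' + 2))/(4s)`, so everything reduces to the log profile `W`
(`CapProfile.exists_logProfile`): `W' = P - 2` with the slope defect `P` of
`helper_capProfile_slope`, obtained by one integration. The profile is glued to the round formula
through `s = 0` by `prof(s) = e^{W(½ log θ(s))} (a² + θ(s))/(a² + ζ(s))` with a smooth positive
clamp `θ` (`θ(s) = s` for `s ≥ 3s_J/4`, `θ ≥ s_J/2`) and a smooth cut `ζ` (`ζ(s) = s` for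
`s ≥ -a²/2`, `a² + ζ > 0`), which makes `prof` smooth on all of `ℝ` and literally equal to
`2Aa/(a² + s)` on `[-a²/2, s_J]`.
-/

noncomputable section

set_option linter.dupNamespace false

open scoped ContDiff Topology
open Set Filter

namespace Summit.SmoothPoincare4.SmoothPoincare4.Theorems

namespace CapProfile

/-- **The log profile.** For `0 < c ≤ 1`, `κ₁ > 0`, `ℓ ≥ 1`, `smax > 0` there are a smooth
`W : ℝ → ℝ` and reals `κ`, `a > 0`, `t_B < t_c` with `e^{2 t_c} ≤ smax` such that
`W(t) = κ - log(a² + e^{2t})` for `t ≤ t_B` (round), `W(t) = log c - (1 + c) t` for `t ≥ t_c`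
(cone), `W'' + W'(W' + 2) ≤ 0`, `|W'(t₁) - W'(t₂)| ≤ κ₁` for `t_B - ℓ ≤ t₁ ≤ t₂ ≤ t₁ + ℓ`, and
`-2 ≤ W' ≤ -(1 + c) + κ₁` on `[t_B - ℓ, ∞)`. -/
theorem exists_logProfile :
    ∀ c : ℝ, 0 < c → c ≤ 1 → ∀ κ₁ : ℝ, 0 < κ₁ → ∀ ℓ : ℝ, 1 ≤ ℓ → ∀ smax : ℝ, 0 < smax →
      ∃ W : ℝ → ℝ, ∃ κ a tB tc : ℝ, ContDiff ℝ ∞ W ∧ 0 < a ∧ tB < tc ∧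
        Real.exp (2 * tc) ≤ smax ∧
        (∀ t, t ≤ tB → W t = κ - Real.log (a ^ 2 + Real.exp (2 * t))) ∧
        (∀ t, tc ≤ t → W t = Real.log c - (1 + c) * t) ∧
        (∀ t, deriv (deriv W) t + deriv W t * (deriv W t + 2) ≤ 0) ∧
        (∀ t₁ t₂, tB - ℓ ≤ t₁ → t₁ ≤ t₂ → t₂ ≤ t₁ + ℓ → |deriv W t₁ - deriv W t₂| ≤ κ₁) ∧
        (∀ t, tB - ℓ ≤ t → -2 ≤ deriv W t ∧ deriv W t ≤ -(1 + c) + κ₁) := by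
  intro c hc hc1 κ₁ hκ₁ ℓ hℓ smax hsmax
  obtain ⟨P, a, tB, tc, hPs, ha, hBc, hcs, hP1, hP2, hP3, hP4, hP5⟩ :=
    helper_capProfile_slope c hc hc1 κ₁ hκ₁ ℓ hℓ smax hsmax
  have hPc : Continuous fun u => P u - 2 := hPs.continuous.sub continuous_const
  set W : ℝ → ℝ := fun t => Real.log c - (1 + c) * tc + ∫ u in tc..t, (P u - 2) with hW
  have hWd : ∀ t, HasDerivAt W (P t - 2) t := fun t =>
    ((hPc.integral_hasStrictDerivAt tc t).hasDerivAt).const_add _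
  have hW' : deriv W = fun t => P t - 2 := funext fun t => (hWd t).deriv
  have hW'' : ∀ t, deriv (deriv W) t = deriv P t := fun t => by
    rw [hW']
    exact deriv_sub_const _
  have hWs : ContDiff ℝ ∞ W :=
    contDiff_infty_iff_deriv.2 ⟨fun t => (hWd t).differentiableAt,
      by rw [hW']; exact hPs.sub contDiff_const⟩
  refine ⟨W, W tB + Real.log (a ^ 2 + Real.exp (2 * tB)), a, tB, tc, hWs, ha, hBc, hcs,
    ?_, ?_, ?_, ?_, ?_⟩
  · -- the round part: integrate `P - 2 = (-log (a² + e^{2u}))'` from `t_B` down to `t`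
    intro t ht
    have hint : W t - W tB = ∫ u in tB..t, (P u - 2) := by
      simp only [hW]
      rw [← intervalIntegral.integral_interval_sub_left (hPc.intervalIntegrable tc t)
        (hPc.intervalIntegrable tc tB)]
      ring
    have hF : ∀ u, HasDerivAt (fun u => -Real.log (a ^ 2 + Real.exp (2 * u)))
        (-(Real.exp (2 * u) * 2 / (a ^ 2 + Real.exp (2 * u)))) u := by
      intro u
      have hE : HasDerivAt (fun u : ℝ => Real.exp (2 * u)) (Real.exp (2 * u) * 2) u := by
        simpa using ((hasDerivAt_id u).const_mul (2 : ℝ)).exp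
      have hpos : 0 < a ^ 2 + Real.exp (2 * u) := by positivity
      exact ((hE.const_add (a ^ 2)).log hpos.ne').fun_neg
    have hftc : ∫ u in tB..t, (P u - 2) =
        -Real.log (a ^ 2 + Real.exp (2 * t)) - -Real.log (a ^ 2 + Real.exp (2 * tB)) := by
      refine intervalIntegral.integral_eq_sub_of_hasDerivAt
        (f := fun u => -Real.log (a ^ 2 + Real.exp (2 * u)))
        (fun u hu => (hF u).congr_deriv ?_) (hPc.intervalIntegrable _ _)
      rw [Set.uIcc_of_ge ht] at hu
      rw [hP1 u hu.2]
      have hpos : 0 < a ^ 2 + Real.exp (2 * u) := by positivity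
      field_simp
      ring
    linarith [hint, hftc]
  · -- the cone part
    intro t ht
    have h1 : ∫ u in tc..t, (P u - 2) = ∫ _ in tc..t, (-(1 + c) : ℝ) := by
      refine intervalIntegral.integral_congr fun u hu => ?_
      rw [Set.uIcc_of_le ht] at hu
      simp only [hP2 u hu.1]
      ring
    simp only [hW]
    rw [h1, intervalIntegral.integral_const, smul_eq_mul]
    ring
  · intro t
    rw [hW'', hW']
    have := hP3 t
    nlinarith
  · intro t₁ t₂ h1 h12 h2
    rw [hW']
    simpa using hP4 t₁ t₂ h1 h12 h2
  · intro t ht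
    rw [hW']
    have := hP5 t ht
    constructor <;> linarith

/-- The positive clamp `θ(s) = s_J/2 + (s - s_J/2) ST(4s/s_J - 2)` equals `s` on `[3s_J/4, ∞)`. -/
theorem clamp_eq_self {sJ s : ℝ} (hsJ : 0 < sJ) (hs : 3 * sJ / 4 ≤ s) :
    sJ / 2 + (s - sJ / 2) * Real.smoothTransition (4 * s / sJ - 2) = s := by
  rw [Real.smoothTransition.one_of_one_le]
  · ring
  rw [le_sub_iff_add_le, le_div_iff₀ hsJ]
  linarith

/-- The clamp is `≥ s_J/2`. -/
theorem half_le_clamp {sJ : ℝ} (hsJ : 0 < sJ) (s : ℝ) :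
    sJ / 2 ≤ sJ / 2 + (s - sJ / 2) * Real.smoothTransition (4 * s / sJ - 2) := by
  rcases le_or_gt (sJ / 2) s with h | h
  · have := Real.smoothTransition.nonneg (4 * s / sJ - 2)
    nlinarith
  · rw [Real.smoothTransition.zero_of_nonpos]
    · simp
    rw [sub_nonpos, div_le_iff₀ hsJ]
    linarith

/-- The clamp is `≤ s_J` on `(-∞, s_J]`. -/
theorem clamp_le {sJ s : ℝ} (hsJ : 0 < sJ) (hs : s ≤ sJ) :
    sJ / 2 + (s - sJ / 2) * Real.smoothTransition (4 * s / sJ - 2) ≤ sJ := by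
  rcases le_or_gt (sJ / 2) s with h | h
  · have := Real.smoothTransition.le_one (4 * s / sJ - 2)
    nlinarith
  · rw [Real.smoothTransition.zero_of_nonpos]
    · linarith
    rw [sub_nonpos, div_le_iff₀ hsJ]
    linarith

/-- The cut `ζ(s) = s ST(4s/b + 3)` equals `s` on `[-b/2, ∞)`. -/
theorem cut_eq_self {b s : ℝ} (hb : 0 < b) (hs : -(b / 2) ≤ s) :
    s * Real.smoothTransition (4 * s / b + 3) = s := by
  rw [Real.smoothTransition.one_of_one_le]
  · ring
  have : -2 ≤ 4 * s / b := by
    rw [le_div_iff₀ hb]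
    linarith
  linarith

/-- `b + ζ(s) > 0` everywhere. -/
theorem cut_den_pos {b : ℝ} (hb : 0 < b) (s : ℝ) :
    0 < b + s * Real.smoothTransition (4 * s / b + 3) := by
  rcases le_or_gt (-(b / 2)) s with h | h
  · rw [cut_eq_self hb h]
    linarith
  rcases le_or_gt s (-(3 * b / 4)) with h2 | h2
  · rw [Real.smoothTransition.zero_of_nonpos]
    · simpa using hb
    have : 4 * s / b ≤ -3 := by
      rw [div_le_iff₀ hb]
      linarith
    linarith
  · have h0 := Real.smoothTransition.nonneg (4 * s / b + 3)
    have h1 := Real.smoothTransition.le_one (4 * s / b + 3)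
    nlinarith

end CapProfile

open CapProfile in
/-- **K1: the capping profile** `prof(s)` (`s = ρ²`): exactly round `2Aa/(a²+s)` on `[0, s_J]`,
exactly the cone `c s^{−(c+1)/2}` from `s_c ≤ smax` on, positive, `R ≥ 0` in the form
`2 prof' + s prof'' ≤ 0`, `prof'(0) < 0`, and slowly varying log-slope
`Q(s) = 2 s prof'/prof ∈ [−2, −(1+c)+κ₁]` beyond `s_J e^{−2ℓ}`: `|Q(s₁) − Q(s₂)| ≤ κ₁` whenever
`s_J e^{−2ℓ} ≤ s₁ ≤ s₂ ≤ s₁ e^{2ℓ}`. -/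
theorem helper_capProfile :
    ∀ c : ℝ, 0 < c → c ≤ 1 → ∀ κ₁ : ℝ, 0 < κ₁ → ∀ ℓ : ℝ, 1 ≤ ℓ → ∀ smax : ℝ, 0 < smax →
      ∃ prof : ℝ → ℝ, ∃ A a sJ sc : ℝ, ContDiff ℝ ∞ prof ∧ 0 < A ∧ 0 < a ∧ 0 < sJ ∧ sJ < sc ∧ sc ≤ smax ∧
        (∀ s, 0 ≤ s → s ≤ sJ → prof s = 2 * A * a / (a ^ 2 + s)) ∧
        (∀ s, sc ≤ s → prof s = c * s ^ (-(c + 1) / 2)) ∧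
        (∀ s, 0 ≤ s → 0 < prof s) ∧
        (∀ s, 0 ≤ s → 2 * deriv prof s + s * deriv (deriv prof) s ≤ 0) ∧
        deriv prof 0 < 0 ∧
        (∀ s₁ s₂, sJ * Real.exp (-2 * ℓ) ≤ s₁ → s₁ ≤ s₂ → s₂ ≤ s₁ * Real.exp (2 * ℓ) →
          |2 * s₁ * deriv prof s₁ / prof s₁ - 2 * s₂ * deriv prof s₂ / prof s₂| ≤ κ₁) ∧
        (∀ s, sJ * Real.exp (-2 * ℓ) ≤ s →
          -2 ≤ 2 * s * deriv prof s / prof s ∧ 2 * s * deriv prof s / prof s ≤ -(1 + c) + κ₁) := by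
  intro c hc hc1 κ₁ hκ₁ ℓ hℓ smax hsmax
  obtain ⟨W, κ, a, tB, tc, hWs, ha, hBc, hcs, hW1, hW2, hW3, hW4, hW5⟩ :=
    exists_logProfile c hc hc1 κ₁ hκ₁ ℓ hℓ smax hsmax
  set sJ : ℝ := Real.exp (2 * tB) with hsJ
  have hsJ0 : 0 < sJ := Real.exp_pos _
  have ha2 : 0 < a ^ 2 := by positivity
  have hlogsJ : Real.log sJ = 2 * tB := Real.log_exp _
  set θ : ℝ → ℝ := fun s => sJ / 2 + (s - sJ / 2) * Real.smoothTransition (4 * s / sJ - 2) with hθ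
  set ζ : ℝ → ℝ := fun s => s * Real.smoothTransition (4 * s / a ^ 2 + 3) with hζ
  set prof : ℝ → ℝ := fun s =>
    Real.exp (W (Real.log (θ s) / 2)) * ((a ^ 2 + θ s) / (a ^ 2 + ζ s)) with hprof
  have hθpos : ∀ s, 0 < θ s := fun s => lt_of_lt_of_le (half_pos hsJ0) (half_le_clamp hsJ0 s)
  have hζden : ∀ s, 0 < a ^ 2 + ζ s := fun s => cut_den_pos ha2 s
  -- smoothness
  have hθs : ContDiff ℝ ∞ θ :=
    contDiff_const.add ((contDiff_id.sub contDiff_const).mul (Real.smoothTransition.contDiff.comp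
      (((contDiff_const.mul contDiff_id).div_const _).sub contDiff_const)))
  have hζs : ContDiff ℝ ∞ ζ :=
    contDiff_id.mul (Real.smoothTransition.contDiff.comp
      (((contDiff_const.mul contDiff_id).div_const _).add contDiff_const))
  have hprofs : ContDiff ℝ ∞ prof :=
    (hWs.comp ((hθs.log fun s => (hθpos s).ne').div_const 2)).exp.mul
      ((contDiff_const.add hθs).div (contDiff_const.add hζs) fun s => (hζden s).ne')
  -- (I) below `s_J` the profile is `e^κ/(a² + ζ s)`
  have hI : ∀ s, s ≤ sJ → prof s = Real.exp κ / (a ^ 2 + ζ s) := by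
    intro s hs
    have h2 : Real.log (θ s) / 2 ≤ tB := by
      have := Real.log_le_log (hθpos s) (clamp_le hsJ0 hs)
      linarith [hlogsJ]
    have h3 : W (Real.log (θ s) / 2) = κ - Real.log (a ^ 2 + θ s) := by
      rw [hW1 _ h2, mul_div_cancel₀ _ two_ne_zero, Real.exp_log (hθpos s)]
    have h4 : 0 < a ^ 2 + θ s := by linarith [hθpos s]
    simp only [hprof]
    rw [h3, Real.exp_sub, Real.exp_log h4]
    field_simp
  -- (Ia) on `[-a²/2, s_J]` it is the round formula
  have hIa : ∀ s, -(a ^ 2 / 2) ≤ s → s ≤ sJ → prof s = Real.exp κ / (a ^ 2 + s) := by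
    intro s h1 h2
    rw [hI s h2]
    simp only [hζ]
    rw [cut_eq_self ha2 h1]
  -- (III) on `(0, ∞)` it is `e^{W(log s / 2)}`
  have hIII : ∀ s, 0 < s → prof s = Real.exp (W (Real.log s / 2)) := by
    intro s hs
    rcases le_or_gt (3 * sJ / 4) s with h | h
    · have hθ1 : θ s = s := clamp_eq_self hsJ0 h
      have hζ1 : ζ s = s := cut_eq_self ha2 (by linarith)
      have h4 : a ^ 2 + s ≠ 0 := by positivity
      simp only [hprof]
      rw [hθ1, hζ1, div_self h4, mul_one]
    · rw [hIa s (by linarith) (by linarith)]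
      have h2 : Real.log s / 2 ≤ tB := by
        have := Real.log_le_log hs (by linarith : s ≤ sJ)
        linarith [hlogsJ]
      rw [hW1 _ h2, mul_div_cancel₀ _ two_ne_zero, Real.exp_log hs, Real.exp_sub,
        Real.exp_log (by positivity : 0 < a ^ 2 + s)]
  have hev : ∀ s, 0 < s → prof =ᶠ[𝓝 s] fun s => Real.exp (W (Real.log s / 2)) := fun s hs => by
    filter_upwards [Ioi_mem_nhds hs] with x hx using hIII x hx
  -- derivatives of `s ↦ e^{W(log s / 2)}`
  have hWd : ∀ t, HasDerivAt W (deriv W t) t := fun t =>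
    (hWs.differentiable (by simp) t).hasDerivAt
  have hW's : ContDiff ℝ ∞ (deriv W) := (contDiff_infty_iff_deriv.1 hWs).2
  have hWdd : ∀ t, HasDerivAt (deriv W) (deriv (deriv W) t) t := fun t =>
    (hW's.differentiable (by simp) t).hasDerivAt
  have hh1 : ∀ s, 0 < s → HasDerivAt (fun s => Real.exp (W (Real.log s / 2)))
      (Real.exp (W (Real.log s / 2)) * (deriv W (Real.log s / 2) * (s⁻¹ / 2))) s := by
    intro s hs
    have hl : HasDerivAt (fun s => Real.log s / 2) (s⁻¹ / 2) s :=
      (Real.hasDerivAt_log hs.ne').div_const 2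
    exact ((hWd _).comp s hl).exp
  have hderiv1 : ∀ s, 0 < s → deriv prof s =
      Real.exp (W (Real.log s / 2)) * (deriv W (Real.log s / 2) * (s⁻¹ / 2)) := by
    intro s hs
    rw [(hev s hs).deriv_eq]
    exact (hh1 s hs).deriv
  have hh2 : ∀ s, 0 < s → HasDerivAt
      (fun s => Real.exp (W (Real.log s / 2)) * (deriv W (Real.log s / 2) * (s⁻¹ / 2)))
      (Real.exp (W (Real.log s / 2)) * (deriv W (Real.log s / 2) * (s⁻¹ / 2))
          * (deriv W (Real.log s / 2) * (s⁻¹ / 2))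
        + Real.exp (W (Real.log s / 2)) * (deriv (deriv W) (Real.log s / 2) * (s⁻¹ / 2)
          * (s⁻¹ / 2) + deriv W (Real.log s / 2) * (-(s ^ 2)⁻¹ / 2))) s := by
    intro s hs
    have hl : HasDerivAt (fun s => Real.log s / 2) (s⁻¹ / 2) s :=
      (Real.hasDerivAt_log hs.ne').div_const 2
    have hi : HasDerivAt (fun s : ℝ => s⁻¹ / 2) (-(s ^ 2)⁻¹ / 2) s :=
      (hasDerivAt_inv hs.ne').div_const 2
    exact (hh1 s hs).fun_mul (((hWdd _).comp s hl).fun_mul hi)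
  have hderiv2 : ∀ s, 0 < s → deriv (deriv prof) s =
      Real.exp (W (Real.log s / 2)) * (deriv W (Real.log s / 2) * (s⁻¹ / 2))
          * (deriv W (Real.log s / 2) * (s⁻¹ / 2))
        + Real.exp (W (Real.log s / 2)) * (deriv (deriv W) (Real.log s / 2) * (s⁻¹ / 2)
          * (s⁻¹ / 2) + deriv W (Real.log s / 2) * (-(s ^ 2)⁻¹ / 2)) := by
    intro s hs
    have hev' : deriv prof =ᶠ[𝓝 s]
        fun s => Real.exp (W (Real.log s / 2)) * (deriv W (Real.log s / 2) * (s⁻¹ / 2)) := by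
      filter_upwards [Ioi_mem_nhds hs] with x hx using hderiv1 x hx
    rw [hev'.deriv_eq]
    exact (hh2 s hs).deriv
  -- the log-slope `Q(s) = W'(log s / 2)`
  have hQ : ∀ s, 0 < s → 2 * s * deriv prof s / prof s = deriv W (Real.log s / 2) := by
    intro s hs
    rw [hderiv1 s hs, hIII s hs]
    field_simp
  -- the derivative at `0`
  have hev0 : prof =ᶠ[𝓝 0] fun s => Real.exp κ / (a ^ 2 + s) := by
    have : Ioo (-(a ^ 2 / 2)) sJ ∈ 𝓝 (0 : ℝ) := Ioo_mem_nhds (by linarith) hsJ0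
    filter_upwards [this] with x hx using hIa x hx.1.le hx.2.le
  have hd0 : deriv prof 0 = -Real.exp κ / (a ^ 2) ^ 2 := by
    rw [hev0.deriv_eq, ((hasDerivAt_const (0 : ℝ) (Real.exp κ)).fun_div
      ((hasDerivAt_id' (0 : ℝ)).const_add (a ^ 2)) (by positivity)).deriv]
    simp
  have hd0neg : deriv prof 0 < 0 := by
    rw [hd0]
    exact div_neg_of_neg_of_pos (neg_neg_of_pos (Real.exp_pos κ)) (by positivity)
  -- windows in `s` are windows in `t = log s / 2`
  have hwin : ∀ s, sJ * Real.exp (-2 * ℓ) ≤ s → 0 < s ∧ tB - ℓ ≤ Real.log s / 2 := by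
    intro s hs
    have hs0 : 0 < s := lt_of_lt_of_le (by positivity) hs
    have := Real.log_le_log (by positivity) hs
    rw [Real.log_mul hsJ0.ne' (Real.exp_pos _).ne', hlogsJ, Real.log_exp] at this
    exact ⟨hs0, by linarith⟩
  refine ⟨prof, Real.exp κ / (2 * a), a, sJ, Real.exp (2 * tc), hprofs, by positivity, ha, hsJ0,
    Real.exp_lt_exp.2 (by linarith), hcs, ?_, ?_, ?_, ?_, hd0neg, ?_, ?_⟩
  · -- (1) round on `[0, s_J]`
    intro s hs0 hs1
    rw [hIa s (by linarith) hs1]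
    field_simp
  · -- (2) cone on `[s_c, ∞)`
    intro s hs
    have hs0 : 0 < s := lt_of_lt_of_le (Real.exp_pos _) hs
    have ht : tc ≤ Real.log s / 2 := by
      have := Real.log_le_log (Real.exp_pos _) hs
      rw [Real.log_exp] at this
      linarith
    rw [hIII s hs0, hW2 _ ht, Real.rpow_def_of_pos hs0,
      show Real.log c - (1 + c) * (Real.log s / 2) = Real.log c + Real.log s * (-(c + 1) / 2) by
        ring, Real.exp_add, Real.exp_log hc]
  · -- (3) positivity
    intro s _
    exact mul_pos (Real.exp_pos _) (div_pos (by linarith [hθpos s]) (hζden s))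
  · -- (4) `2 prof' + s prof'' ≤ 0`
    intro s hs0
    rcases hs0.eq_or_lt with h | h
    · rw [← h, zero_mul, add_zero]
      linarith
    · rw [hderiv1 s h, hderiv2 s h]
      have key : 2 * (Real.exp (W (Real.log s / 2)) * (deriv W (Real.log s / 2) * (s⁻¹ / 2)))
          + s * (Real.exp (W (Real.log s / 2)) * (deriv W (Real.log s / 2) * (s⁻¹ / 2))
              * (deriv W (Real.log s / 2) * (s⁻¹ / 2))
            + Real.exp (W (Real.log s / 2)) * (deriv (deriv W) (Real.log s / 2) * (s⁻¹ / 2)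
              * (s⁻¹ / 2) + deriv W (Real.log s / 2) * (-(s ^ 2)⁻¹ / 2)))
          = Real.exp (W (Real.log s / 2)) / (4 * s) * (deriv (deriv W) (Real.log s / 2)
            + deriv W (Real.log s / 2) * (deriv W (Real.log s / 2) + 2)) := by
        field_simp
        ring
      rw [key]
      exact mul_nonpos_of_nonneg_of_nonpos (by positivity) (hW3 _)
  · -- (6) slow variation of the log-slope
    intro s₁ s₂ h1 h12 h2
    obtain ⟨hs1, ht1⟩ := hwin s₁ h1
    have hs2 : 0 < s₂ := by linarith
    rw [hQ s₁ hs1, hQ s₂ hs2]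
    refine hW4 _ _ ht1 (by linarith [Real.log_le_log hs1 h12]) ?_
    have := Real.log_le_log hs2 h2
    rw [Real.log_mul hs1.ne' (Real.exp_pos _).ne', Real.log_exp] at this
    linarith
  · -- (7) range of the log-slope
    intro s h1
    obtain ⟨hs, ht⟩ := hwin s h1
    rw [hQ s hs]
    exact hW5 _ ht

end Summit.SmoothPoincare4.SmoothPoincare4.Theorems

end
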